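import Literature.MathematicalPhysics.QuantumFieldTheory.Federbush1986.LipschitzMollifier

/-!
# `Federbush1986.PuncturedBallMaps` — [Federbush1988PhaseCellIV] Appendix A part D, the two maps of the punctured ball behind
# **Theorem A.4** (A.34)–(A.38) p. 343: the 0-homogeneous extension `y ↦ f(x₀ + (y − x₀)/|y − x₀|)` of a boundary datum and a
# smooth radial map folding the punctured ball onto the annulus `½ ≤ |x| ≤ 1`

statement-level skeleton of published theorems with citation tags; proofs where landed; nothing here is a claim about the Yang–Mills mass gap

CITATION HEADER.  P. Federbush, *A phase cell approach to Yang–Mills theory. IV. The choice of variables*, Commun. Math.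
Phys. **114** (1988) 317–343 [Federbush1988PhaseCellIV], Appendix A part D «Geometric Construction 6», Theorem A.4 and its
proof (A.37)–(A.38) p. 343.  Cell `lit-balaban`, Phase-2 proof seat **p04 gen 7**; SKELETON row **F4.ThmA.4** (decl of record
`PhaseCellIVAppA.ThmA4ContCap`, p251889; fold owner r19).  Engine input BY NAME: `LipschitzMollifier` (`Euc`).

WHAT IS PRINTED (p. 343): «We define `d′ ∈ C^∞`, `d′ : B → R¹`, such that `½ d(x, ∂B ∪ x₀) ≤ d′(x) ≤ d(x, ∂B ∪ x₀)` (A.37) and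
follow the construction of subsect. C using `f^{es′}_ε(x) = ∫ dy w^{εd′(x)}(x − y) f((y − x₀)/|y − x₀| + x₀)` (A.38) instead of
(A.30).  Notice that in this equation the argument of `f` remains on `∂B`. … The theorem follows via the same route as above
in a straightforward manner.»

WHAT THIS MODULE PROVIDES (centre `x₀ = 0`; namespace `PuncturedBall`), the two elementary maps of that route:
* §1 the radial projection `y ↦ y/|y|` is `(2/ρ)`-Lipschitz on `{|y| ≥ ρ}` (`norm_radial_sub_radial_le`); the 0-HOMOGENEOUS
  EXTENSION `radExt f (y) = f(y/|y|)` of `f : ∂B → M` (the integrand of (A.38)): values in `M` off the origin, `= f` on `∂B`,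
  `LipschitzOnWith (4Λ₁(f))` on `{|y| ≥ ½}` (`lipschitzOnWith_radExt`);
* §2 the least Lipschitz constant `sInf {K | LipschitzWith K f}` is a Lipschitz constant (`lipschitzWith_sInf`) — so that ONE
  construction serves every admissible `Λ₁`-bound of the capped statement;
* §3 the smooth RADIAL FOLD `fold x = (Λ(|x|)/|x|)·x`, `Λ(r) = ½ + smoothTransition(4r − 2)(r − ½)`: `C^∞` off the origin, the
  identity for `|x| ≥ ¾`, `= x/(2|x|)` (0-homogeneous) for `|x| ≤ ½`, `½ ≤ |fold x| ≤ max(½, |x|)`, and the scale-invariant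
  derivative bounds `‖D^i fold(x)‖ ≤ T_i |x|^{−i}` on `0 < |x| ≤ 1` (`exists_fold_bound`; compactness on `¼ ≤ |x| ≤ 1` and the
  dilation identity below `¼`) — this is how the factor `|x − x₀|^{−1}·d(x, ∂B ∪ x₀)^{−(|α|−1)}` of (A.36) arises here.
No `Prop`-valued definition, no named fact; axioms standard.
-/

namespace Literature.MathematicalPhysics.QuantumFieldTheory.Federbush1986

noncomputable section

open Metric Set Filter Function Real
open scoped ContDiff Topology NNReal

namespace PuncturedBall

open LipschitzMollifier

variable {n t : ℕ}

/-! ## §1 The radial projection and the 0-homogeneous extension of a boundary datum -/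

/-- `|a/|a| − b/|b|| ≤ (2/ρ)|a − b|` for `|a|, |b| ≥ ρ > 0`. [cite: Federbush1988PhaseCellIV, (A.38) p. 343] -/
theorem norm_radial_sub_radial_le {F : Type*} [NormedAddCommGroup F] [NormedSpace ℝ F] {ρ : ℝ} (hρ : 0 < ρ) {a b : F}
    (ha : ρ ≤ ‖a‖) (hb : ρ ≤ ‖b‖) : ‖‖a‖⁻¹ • a - ‖b‖⁻¹ • b‖ ≤ 2 / ρ * ‖a - b‖ := by
  have ha0 : 0 < ‖a‖ := hρ.trans_le ha
  have hb0 : 0 < ‖b‖ := hρ.trans_le hb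
  have hsplit : ‖a‖⁻¹ • a - ‖b‖⁻¹ • b = ‖a‖⁻¹ • (a - b) + (‖a‖⁻¹ - ‖b‖⁻¹) • b := by
    rw [smul_sub, sub_smul]; abel
  calc ‖‖a‖⁻¹ • a - ‖b‖⁻¹ • b‖ ≤ ‖‖a‖⁻¹ • (a - b)‖ + ‖(‖a‖⁻¹ - ‖b‖⁻¹) • b‖ := by rw [hsplit]; exact norm_add_le _ _
    _ = ‖a‖⁻¹ * ‖a - b‖ + |‖b‖ - ‖a‖| * ‖a‖⁻¹ := by
        rw [norm_smul, norm_smul, norm_inv, norm_norm, Real.norm_eq_abs, inv_sub_inv ha0.ne' hb0.ne', abs_div,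
          abs_of_pos (mul_pos ha0 hb0)]
        field_simp
    _ ≤ ‖a‖⁻¹ * ‖a - b‖ + ‖a - b‖ * ‖a‖⁻¹ := by
        have : |‖b‖ - ‖a‖| ≤ ‖a - b‖ := by rw [norm_sub_rev]; exact abs_norm_sub_norm_le b a
        gcongr
    _ = 2 / ‖a‖ * ‖a - b‖ := by ring
    _ ≤ 2 / ρ * ‖a - b‖ := by gcongr

/-- A nonzero vector normalised lies on the unit sphere. [cite: Federbush1988PhaseCellIV, (A.38) p. 343] -/
theorem inv_norm_smul_mem_sphere {y : Euc n} (hy : y ≠ 0) : ‖y‖⁻¹ • y ∈ sphere (0 : Euc n) 1 := by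
  rw [mem_sphere, dist_zero_right, norm_smul, norm_inv, norm_norm, inv_mul_cancel₀ (norm_ne_zero_iff.2 hy)]

/-- The 0-HOMOGENEOUS EXTENSION `y ↦ f(y/|y|)` of a boundary datum `f : ∂B → M ⊆ R^t` (the integrand of (A.38) at `x₀ = 0`;
value `0` at the origin, never used). [cite: Federbush1988PhaseCellIV, (A.38) p. 343] -/
def radExt {M : Set (Euc t)} (f : ↥(sphere (0 : Euc n) 1) → ↥M) (y : Euc n) : Euc t :=
  if hy : y = 0 then 0 else (f ⟨‖y‖⁻¹ • y, inv_norm_smul_mem_sphere hy⟩ : Euc t)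

/-- Off the origin the extension is `f` at the normalised point. [cite: Federbush1988PhaseCellIV, (A.38) p. 343] -/
theorem radExt_of_ne {M : Set (Euc t)} (f : ↥(sphere (0 : Euc n) 1) → ↥M) {y : Euc n} (hy : y ≠ 0) :
    radExt f y = (f ⟨‖y‖⁻¹ • y, inv_norm_smul_mem_sphere hy⟩ : Euc t) := by
  unfold radExt; rw [dif_neg hy]

/-- «the argument of `f` remains on `∂B`»: the extension takes values in `M` off the origin. [cite: Federbush1988PhaseCellIV,
(A.38) p. 343] -/
theorem radExt_mem {M : Set (Euc t)} (f : ↥(sphere (0 : Euc n) 1) → ↥M) {y : Euc n} (hy : y ≠ 0) : radExt f y ∈ M := by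
  rw [radExt_of_ne f hy]; exact (f _).2

/-- On `∂B` the extension is `f` itself ((A.35) will come from this). [cite: Federbush1988PhaseCellIV, (A.35), (A.38) p. 343] -/
theorem radExt_eq_of_mem_sphere {M : Set (Euc t)} (f : ↥(sphere (0 : Euc n) 1) → ↥M) {y : Euc n}
    (hy : y ∈ sphere (0 : Euc n) 1) : radExt f y = (f ⟨y, hy⟩ : Euc t) := by
  have hy1 : ‖y‖ = 1 := by rwa [mem_sphere, dist_zero_right] at hy
  have hy0 : y ≠ 0 := by intro h; rw [h, norm_zero] at hy1; exact zero_ne_one hy1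
  rw [radExt_of_ne f hy0]
  congr 2
  exact Subtype.ext (by simp [hy1])

/-- The extension of a `Λ₁`-Lipschitz datum is `4Λ₁`-Lipschitz on `{|y| ≥ ½}` (radial projection `(2/ρ)`-Lipschitz, `ρ = ½`).
[cite: Federbush1988PhaseCellIV, (A.36), (A.38) p. 343] -/
theorem lipschitzOnWith_radExt {M : Set (Euc t)} {f : ↥(sphere (0 : Euc n) 1) → ↥M} {K : ℝ≥0} (hf : LipschitzWith K f) :
    LipschitzOnWith (4 * K) (radExt f) {y : Euc n | 1 / 2 ≤ ‖y‖} := by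
  refine LipschitzOnWith.of_dist_le_mul fun a ha b hb => ?_
  have ha0 : a ≠ 0 := by intro h; simp only [mem_setOf_eq, h, norm_zero] at ha; linarith
  have hb0 : b ≠ 0 := by intro h; simp only [mem_setOf_eq, h, norm_zero] at hb; linarith
  rw [radExt_of_ne f ha0, radExt_of_ne f hb0, ← Subtype.dist_eq]
  refine (hf.dist_le_mul _ _).trans ?_
  rw [Subtype.dist_eq, dist_eq_norm, dist_eq_norm, NNReal.coe_mul]
  have := norm_radial_sub_radial_le (by norm_num : (0 : ℝ) < 1 / 2) ha hb
  calc (K : ℝ) * ‖‖a‖⁻¹ • a - ‖b‖⁻¹ • b‖ ≤ K * (2 / (1 / 2) * ‖a - b‖) := by gcongr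
    _ = ((4 : ℝ≥0) : ℝ) * K * ‖a - b‖ := by push_cast; ring

/-! ## §2 The least Lipschitz constant is a Lipschitz constant -/

/-- If `f` has a Lipschitz constant, the infimum of its Lipschitz constants is one. [cite: Federbush1988PhaseCellIV, (11.4) p. 338,
Theorem A.4 (A.36) p. 343] -/
theorem lipschitzWith_sInf {α β : Type*} [PseudoMetricSpace α] [PseudoMetricSpace β] {f : α → β} {K₀ : ℝ≥0}
    (h : LipschitzWith K₀ f) : LipschitzWith (sInf {K : ℝ≥0 | LipschitzWith K f}) f := by
  refine LipschitzWith.of_dist_le_mul fun x y => ?_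
  rcases eq_or_lt_of_le (dist_nonneg : 0 ≤ dist x y) with hd | hd
  · have := h.dist_le_mul x y
    rw [← hd, mul_zero] at this ⊢
    exact this
  · rw [← div_le_iff₀ hd]
    have hq : (dist (f x) (f y) / dist x y).toNNReal ≤ sInf {K : ℝ≥0 | LipschitzWith K f} := by
      refine le_csInf ⟨K₀, h⟩ fun K hK => ?_
      rw [Real.toNNReal_le_iff_le_coe, div_le_iff₀ hd]
      exact hK.dist_le_mul x y
    calc dist (f x) (f y) / dist x y ≤ ((dist (f x) (f y) / dist x y).toNNReal : ℝ) := Real.le_coe_toNNReal _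
      _ ≤ _ := NNReal.coe_le_coe.2 hq

/-- … and it is below every Lipschitz constant. [cite: Federbush1988PhaseCellIV, Theorem A.4 (A.36) p. 343] -/
theorem sInf_lipschitz_le {α β : Type*} [PseudoMetricSpace α] [PseudoMetricSpace β] {f : α → β} {K : ℝ≥0}
    (h : LipschitzWith K f) : sInf {K : ℝ≥0 | LipschitzWith K f} ≤ K :=
  csInf_le (OrderBot.bddBelow _) h

/-! ## §3 The smooth radial fold of the punctured ball onto the annulus `½ ≤ |x| ≤ 1` -/

/-- The radial profile `Λ(r) = ½ + smoothTransition(4r − 2)·(r − ½)`: `Λ = ½` on `r ≤ ½`, `Λ = r` on `r ≥ ¾`.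
[cite: Federbush1988PhaseCellIV, (A.37) p. 343] -/
def Lam (r : ℝ) : ℝ := 1 / 2 + smoothTransition (4 * r - 2) * (r - 1 / 2)

/-- [cite: Federbush1988PhaseCellIV, (A.37) p. 343] -/
theorem Lam_of_le {r : ℝ} (h : r ≤ 1 / 2) : Lam r = 1 / 2 := by
  unfold Lam; rw [smoothTransition.zero_of_nonpos (by linarith), zero_mul, add_zero]

/-- [cite: Federbush1988PhaseCellIV, (A.37) p. 343] -/
theorem Lam_of_ge {r : ℝ} (h : 3 / 4 ≤ r) : Lam r = r := by
  unfold Lam; rw [smoothTransition.one_of_one_le (by linarith), one_mul]; ring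

/-- `½ ≤ Λ(r)`. [cite: Federbush1988PhaseCellIV, (A.37) p. 343] -/
theorem half_le_Lam (r : ℝ) : 1 / 2 ≤ Lam r := by
  by_cases h : r ≤ 1 / 2
  · rw [Lam_of_le h]
  · unfold Lam
    have := smoothTransition.nonneg (4 * r - 2)
    nlinarith

/-- `Λ(r) ≤ max(½, r)`. [cite: Federbush1988PhaseCellIV, (A.37) p. 343] -/
theorem Lam_le (r : ℝ) : Lam r ≤ max (1 / 2) r := by
  by_cases h : r ≤ 1 / 2
  · rw [Lam_of_le h]; exact le_max_left _ _
  · refine le_trans ?_ (le_max_right _ _)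
    unfold Lam
    have := smoothTransition.le_one (4 * r - 2)
    nlinarith

/-- `Λ ∈ C^∞`. [cite: Federbush1988PhaseCellIV, (A.37) p. 343] -/
theorem contDiff_Lam : ContDiff ℝ ∞ Lam := by
  unfold Lam
  exact contDiff_const.add ((smoothTransition.contDiff.comp ((contDiff_const.mul contDiff_id).sub contDiff_const)).mul
    (contDiff_id.sub contDiff_const))

/-- The radial fold `x ↦ (Λ(|x|)/|x|)·x` of the punctured ball onto the annulus `½ ≤ |x| ≤ 1`. [cite: Federbush1988PhaseCellIV,
(A.37)–(A.38) p. 343] -/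
def fold (x : Euc n) : Euc n := (Lam ‖x‖ * ‖x‖⁻¹) • x

/-- `|fold x| = Λ(|x|)` off the origin. [cite: Federbush1988PhaseCellIV, (A.37) p. 343] -/
theorem norm_fold {x : Euc n} (hx : x ≠ 0) : ‖fold x‖ = Lam ‖x‖ := by
  have h0 : 0 < ‖x‖ := norm_pos_iff.2 hx
  unfold fold
  rw [norm_smul, Real.norm_eq_abs, abs_of_nonneg (mul_nonneg (by linarith [half_le_Lam ‖x‖]) (inv_nonneg.2 h0.le)),
    mul_assoc, inv_mul_cancel₀ h0.ne', mul_one]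

/-- `½ ≤ |fold x|` off the origin. [cite: Federbush1988PhaseCellIV, (A.37) p. 343] -/
theorem half_le_norm_fold {x : Euc n} (hx : x ≠ 0) : 1 / 2 ≤ ‖fold x‖ := by
  rw [norm_fold hx]; exact half_le_Lam _

/-- `|fold x| ≤ max(½, |x|)`. [cite: Federbush1988PhaseCellIV, (A.37) p. 343] -/
theorem norm_fold_le {x : Euc n} (hx : x ≠ 0) : ‖fold x‖ ≤ max (1 / 2) ‖x‖ := by
  rw [norm_fold hx]; exact Lam_le _

/-- The fold is the identity on `|x| ≥ ¾`. [cite: Federbush1988PhaseCellIV, (A.35), (A.37) p. 343] -/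
theorem fold_eq_self {x : Euc n} (hx : 3 / 4 ≤ ‖x‖) : fold x = x := by
  have h0 : 0 < ‖x‖ := by linarith
  unfold fold
  rw [Lam_of_ge hx, mul_inv_cancel₀ h0.ne', one_smul]

/-- On `|x| ≤ ½` the fold is `x/(2|x|)`, hence 0-homogeneous: `fold (c·x) = fold x` for `c > 0`, `c|x| ≤ ½`.
[cite: Federbush1988PhaseCellIV, (A.37)–(A.38) p. 343] -/
theorem fold_smul {x : Euc n} (hx0 : x ≠ 0) (hx : ‖x‖ ≤ 1 / 2) {c : ℝ} (hc : 0 < c) (hcx : c * ‖x‖ ≤ 1 / 2) :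
    fold (c • x) = fold x := by
  have h0 : 0 < ‖x‖ := norm_pos_iff.2 hx0
  unfold fold
  rw [norm_smul, Real.norm_eq_abs, abs_of_pos hc, Lam_of_le hcx, Lam_of_le hx, smul_smul]
  congr 1
  field_simp

/-- The fold maps the punctured open ball into the open ball. [cite: Federbush1988PhaseCellIV, (A.37) p. 343] -/
theorem fold_mem_ball {x : Euc n} (hx0 : x ≠ 0) (hx : x ∈ ball (0 : Euc n) 1) : fold x ∈ ball (0 : Euc n) 1 := by
  rw [mem_ball, dist_zero_right] at hx ⊢
  exact (norm_fold_le hx0).trans_lt (max_lt (by norm_num) hx)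

/-- … and the punctured closed ball into the closed ball. [cite: Federbush1988PhaseCellIV, (A.37) p. 343] -/
theorem fold_mem_closedBall {x : Euc n} (hx0 : x ≠ 0) (hx : x ∈ closedBall (0 : Euc n) 1) :
    fold x ∈ closedBall (0 : Euc n) 1 := by
  rw [mem_closedBall, dist_zero_right] at hx ⊢
  exact (norm_fold_le hx0).trans (max_le (by norm_num) hx)

/-- The fold is `C^∞` off the origin. [cite: Federbush1988PhaseCellIV, (A.37) p. 343] -/
theorem contDiffAt_fold {x : Euc n} (hx : x ≠ 0) : ContDiffAt ℝ ∞ (fold : Euc n → Euc n) x := by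
  have h1 : ContDiffAt ℝ ∞ (fun z : Euc n => Lam ‖z‖) x := contDiff_Lam.contDiffAt.comp x (contDiffAt_norm ℝ hx)
  have h2 : ContDiffAt ℝ ∞ (fun z : Euc n => ‖z‖⁻¹) x := (contDiffAt_norm ℝ hx).inv (norm_ne_zero_iff.2 hx)
  exact (h1.mul h2).smul contDiffAt_id

/-- [cite: Federbush1988PhaseCellIV, (A.37) p. 343] -/
theorem contDiffOn_fold : ContDiffOn ℝ ∞ (fold : Euc n → Euc n) {x | x ≠ 0} :=
  fun _ hx => (contDiffAt_fold hx).contDiffWithinAt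

/-- [cite: Federbush1988PhaseCellIV, (A.37) p. 343] -/
theorem continuousOn_fold : ContinuousOn (fold : Euc n → Euc n) {x | x ≠ 0} := contDiffOn_fold.continuousOn

/-- The dilation identity below `¼`: for `0 < |x| < ¼` and `c = 1/(4|x|)`, near `x` the fold equals `fold ∘ (c·)`, so
`D^i fold(x) = D^i fold(cx) ∘ (c·id)^{⊗i}`. [cite: Federbush1988PhaseCellIV, (A.36)–(A.38) p. 343] -/
theorem iteratedFDeriv_fold_eq_of_lt {x : Euc n} (hx0 : x ≠ 0) (hx : ‖x‖ < 1 / 4) (i : ℕ) :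
    iteratedFDeriv ℝ i (fold : Euc n → Euc n) x =
      (iteratedFDeriv ℝ i (fold : Euc n → Euc n) ((4 * ‖x‖)⁻¹ • x)).compContinuousLinearMap
        fun _ => (4 * ‖x‖)⁻¹ • ContinuousLinearMap.id ℝ (Euc n) := by
  have h0 : 0 < ‖x‖ := norm_pos_iff.2 hx0
  set c : ℝ := (4 * ‖x‖)⁻¹ with hc
  have hc0 : 0 < c := by positivity
  set L : Euc n →L[ℝ] Euc n := c • ContinuousLinearMap.id ℝ (Euc n) with hL
  have hLapply : ∀ z : Euc n, L z = c • z := fun z => rfl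
  -- `fold = fold ∘ L` near `x`
  have hev : (fold : Euc n → Euc n) =ᶠ[𝓝 x] (fold ∘ L) := by
    have hopen : IsOpen ({z : Euc n | z ≠ 0} ∩ {z : Euc n | ‖z‖ < 2 * ‖x‖}) :=
      isOpen_ne.inter (isOpen_lt continuous_norm continuous_const)
    filter_upwards [hopen.mem_nhds ⟨hx0, by simp only [mem_setOf_eq]; linarith⟩] with z hz
    simp only [comp_apply, hLapply]
    have hz2 : ‖z‖ ≤ 1 / 2 := by have := hz.2; simp only [mem_setOf_eq] at this; linarith
    have hcz : c * ‖z‖ ≤ 1 / 2 := by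
      rw [hc]
      have : ‖z‖ < 2 * ‖x‖ := hz.2
      calc (4 * ‖x‖)⁻¹ * ‖z‖ ≤ (4 * ‖x‖)⁻¹ * (2 * ‖x‖) := by gcongr
        _ = 1 / 2 := by field_simp; norm_num
    exact (fold_smul hz.1 hz2 hc0 hcz).symm
  rw [(hev.iteratedFDeriv ℝ i).eq_of_nhds]
  -- chain rule with the linear map `L` inside the open set `{z ≠ 0}`
  have hpre : L ⁻¹' {z : Euc n | z ≠ 0} = {z : Euc n | z ≠ 0} := by
    ext z; simp only [mem_preimage, mem_setOf_eq, hLapply, smul_ne_zero_iff, ne_eq, hc0.ne', not_false_eq_true, true_and]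
  have hLx : L x ∈ {z : Euc n | z ≠ 0} := by
    simp only [mem_setOf_eq, hLapply, smul_ne_zero_iff]; exact ⟨hc0.ne', hx0⟩
  have key := L.iteratedFDerivWithin_comp_right (f := (fold : Euc n → Euc n)) (n := ∞) (i := i) contDiffOn_fold
    isOpen_ne.uniqueDiffOn (by rw [hpre]; exact isOpen_ne.uniqueDiffOn) hLx (mod_cast le_top)
  rw [hpre, iteratedFDerivWithin_of_isOpen i isOpen_ne hx0, iteratedFDerivWithin_of_isOpen i isOpen_ne hLx] at key
  exact key

/-- **Scale-invariant derivative bounds of the fold**: `‖D^i fold(x)‖ ≤ T_i |x|^{−i}` for `0 < |x| ≤ 1` (compactness on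
`¼ ≤ |x| ≤ 1`, dilation below `¼`). [cite: Federbush1988PhaseCellIV, (A.36)–(A.38) p. 343] -/
theorem exists_fold_bound (i : ℕ) : ∃ T : ℝ, 0 ≤ T ∧ ∀ x : Euc n, x ≠ 0 → ‖x‖ ≤ 1 →
    ‖iteratedFDeriv ℝ i (fold : Euc n → Euc n) x‖ ≤ T * (‖x‖⁻¹) ^ i := by
  -- a bound on the compact annulus `¼ ≤ |x| ≤ 1`
  have hK : IsCompact (closedBall (0 : Euc n) 1 \ ball (0 : Euc n) (1 / 4)) := (isCompact_closedBall _ _).diff isOpen_ball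
  have hKsub : closedBall (0 : Euc n) 1 \ ball (0 : Euc n) (1 / 4) ⊆ {z : Euc n | z ≠ 0} := by
    intro z hz h
    apply hz.2
    rw [h]; exact mem_ball_self (by norm_num)
  have hcont : ContinuousOn (fun z => iteratedFDeriv ℝ i (fold : Euc n → Euc n) z) {z : Euc n | z ≠ 0} := by
    have := contDiffOn_fold.continuousOn_iteratedFDerivWithin (n := ∞) (m := i) (𝕜 := ℝ) (mod_cast le_top)
      isOpen_ne.uniqueDiffOn (E := Euc n) (F := Euc n)
    exact this.congr fun z hz => (iteratedFDerivWithin_of_isOpen i isOpen_ne hz).symm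
  obtain ⟨C, hC⟩ := hK.exists_bound_of_continuousOn (hcont.mono hKsub)
  refine ⟨max C 0, le_max_right _ _, fun x hx0 hx1 => ?_⟩
  have h0 : 0 < ‖x‖ := norm_pos_iff.2 hx0
  have hinv1 : 1 ≤ ‖x‖⁻¹ := (one_le_inv₀ h0).2 hx1
  by_cases hx4 : 1 / 4 ≤ ‖x‖
  · -- on the annulus
    have hxK : x ∈ closedBall (0 : Euc n) 1 \ ball (0 : Euc n) (1 / 4) :=
      ⟨by rwa [mem_closedBall, dist_zero_right], by rwa [mem_ball, dist_zero_right, not_lt]⟩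
    calc ‖iteratedFDeriv ℝ i fold x‖ ≤ C := hC x hxK
      _ ≤ max C 0 * 1 := by rw [mul_one]; exact le_max_left _ _
      _ ≤ max C 0 * (‖x‖⁻¹) ^ i := by gcongr; exact one_le_pow₀ hinv1
  · -- below `¼`: dilate to the sphere of radius `¼`
    rw [not_le] at hx4
    rw [iteratedFDeriv_fold_eq_of_lt hx0 hx4 i]
    have hcx : (4 * ‖x‖)⁻¹ • x ∈ closedBall (0 : Euc n) 1 \ ball (0 : Euc n) (1 / 4) := by
      have hn : ‖(4 * ‖x‖)⁻¹ • x‖ = 1 / 4 := by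
        rw [norm_smul, norm_inv, Real.norm_eq_abs, abs_of_pos (by positivity)]; field_simp
      exact ⟨by rw [mem_closedBall, dist_zero_right, hn]; norm_num, by rw [mem_ball, dist_zero_right, hn]; exact lt_irrefl _⟩
    have hLnorm : ‖(4 * ‖x‖)⁻¹ • ContinuousLinearMap.id ℝ (Euc n)‖ ≤ ‖x‖⁻¹ := by
      rw [norm_smul, norm_inv, Real.norm_eq_abs, abs_of_pos (by positivity)]
      calc (4 * ‖x‖)⁻¹ * ‖ContinuousLinearMap.id ℝ (Euc n)‖ ≤ (4 * ‖x‖)⁻¹ * 1 := by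
            gcongr; exact ContinuousLinearMap.norm_id_le
        _ ≤ ‖x‖⁻¹ := by rw [mul_one]; exact inv_anti₀ h0 (by linarith)
    calc ‖(iteratedFDeriv ℝ i fold ((4 * ‖x‖)⁻¹ • x)).compContinuousLinearMap fun _ => (4 * ‖x‖)⁻¹ • ContinuousLinearMap.id ℝ (Euc n)‖
        ≤ ‖iteratedFDeriv ℝ i fold ((4 * ‖x‖)⁻¹ • x)‖ * ∏ _j : Fin i, ‖(4 * ‖x‖)⁻¹ • ContinuousLinearMap.id ℝ (Euc n)‖ :=
          ContinuousMultilinearMap.norm_compContinuousLinearMap_le _ _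
      _ ≤ max C 0 * ∏ _j : Fin i, ‖x‖⁻¹ :=
          mul_le_mul ((hC _ hcx).trans (le_max_left _ _)) (Finset.prod_le_prod (fun _ _ => norm_nonneg _) fun _ _ => hLnorm)
            (Finset.prod_nonneg fun _ _ => norm_nonneg _) (le_max_right _ _)
      _ = max C 0 * (‖x‖⁻¹) ^ i := by rw [Finset.prod_const, Finset.card_univ, Fintype.card_fin]

end PuncturedBall

end

end Literature.MathematicalPhysics.QuantumFieldTheory.Federbush1986
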